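import Literature.Barriers.HodgeConjecture.SingularVarieties
import Literature.AlgebraicGeometry.Resolution.SmoothStalksRegular
import Literature.AlgebraicGeometry.Resolution.AlterationsStrictTransformModel
import HarnessLib

/-!
# Bloch's singular counterexample: the Hodge-class clause is automatic (proofs)

Proofs for `Literature/Barriers/HodgeConjecture/SingularVarieties.lean`, concerning the named
fact `Bloch1990_cohomologicalHodgeConjecture_singular_counterexample B C` (S. Bloch, letter to
U. Jannsen of 2/11/87 = Appendix A of U. Jannsen, *Mixed Motives and Algebraic K-Theory*,
LNM 1400 (1990), pp. 222–223).

Bloch obtains "`H⁴(W, ℚ(2)) ≅ ℚ^{⊕3}` (as a Hodge structure)", i.e. that EVERY class of `H⁴(W)`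
is a Hodge class, from the exact sequence of (mixed) Hodge structures
`0 → H⁴(W, ℚ(2)) → H⁴(P, ℚ(2))^{⊕2} → H⁴(S, ℚ(2)) → 0` and `CH²(P)_ℚ ⥲ H⁴(P, ℚ(2))`
[cite: Bloch1990LetterJannsen, p. 222]. In the tree's rendering, "Hodge class on the singular
`W`" is `IsHodgeOnSmoothPullbacks B W 2 α` (every pull-back to a smooth projective `Y` is a
Hodge class), and this clause of the fact is a CONSEQUENCE of the other clauses: `W` is covered
by two closed immersions `i₁ i₂ : P ⟶ W` from a smooth projective `P` all of whose degree-`2p`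
cohomology is algebraic. Indeed a smooth projective `Y` is irreducible and reduced, so any
`f : Y ⟶ W` factors through `i₁` or `i₂` (a morphism from a reduced scheme whose range lies in
the range of a closed immersion lifts through it), and `f*α = g*(iⱼ*α)` with `iⱼ*α ∈ ℚ·A^p(P)`
a Hodge class and `g*` a morphism of Hodge structures. Everything here is PROVED:

* `isHodgeOnSmoothPullbacks_of_closedCover`: clauses "(i₁, i₂) closed immersions covering `W`"
  and "`ℚ·Aᵖ(P) = H²ᵖ(P)`" imply that every `α ∈ H²ᵖ(W)` is Hodge on all smooth pull-backs;
* `Bloch1990_cohomologicalHodgeConjecture_singular_counterexample_of_cohomological`: the named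
  fact follows from its purely cohomological / Chern-theoretic clauses (the Hodge clause dropped).

What remains of the fact after this reduction is: the construction of `W = P ∐_S P`,
`P = Bl_x ℙ³`, as a reduced projective `ℂ`-scheme of dimension `3`; the Betti numbers
`b₄(P) = 2` (all algebraic), `b₄(W) = 3` with `H⁴(W) ↪ H⁴(P)²`; and `chernSpanTwo B C W ≠ ⊤`
(Bloch's Chow-group argument, [cite: Bloch1990LetterJannsen, p. 222, "Ker(CH²(P)_ℚ^{⊕2} → CH²(S)) ≅ ℚ^{⊕2}"]).

## References

* [Bloch1990LetterJannsen] S. Bloch, letter to U. Jannsen (2/11/87), Appendix A of LNM 1400,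
  pp. 222–223.
* [Jannsen1990MixedMotives] U. Jannsen, *Mixed Motives and Algebraic K-Theory*, LNM 1400 (1990),
  §7 Remark 7.18.
-/

noncomputable section

open CategoryTheory AlgebraicGeometry

namespace Literature.Barriers.HodgeConjecture

open Literature.AlgebraicGeometry.Motives

variable {B : BettiHodgeData ℂ}

/-- A smooth projective `ℂ`-variety is a reduced scheme (smooth over a field ⇒ regular ⇒
reduced; Stacks 056S/056T, via `Resolution.isReduced_of_smooth`). [folklore] -/
theorem isReduced_left_of_isSmoothProjective {n : ℕ} {Y : SchemeOver ℂ} (hY : IsSmoothProjective n Y) :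
    IsReduced Y.left := by
  haveI := hY.smoothOfRelativeDimension
  haveI : Smooth Y.hom := SmoothOfRelativeDimension.smooth n Y.hom
  exact Literature.AlgebraicGeometry.Resolution.isReduced_of_smooth Y.hom

/-- A morphism from a smooth projective (hence irreducible) `Y` into a scheme covered by the
ranges of two closed immersions `i₁ i₂ : P ⟶ W` has range inside one of them. [folklore] -/
theorem range_subset_or_of_closedCover {n : ℕ} {Y W P : SchemeOver ℂ} (hY : IsSmoothProjective n Y)
    (i₁ i₂ : P ⟶ W) [IsClosedImmersion i₁.left] [IsClosedImmersion i₂.left]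
    (hcov : Set.range (fun x ↦ i₁.left.base x) ∪ Set.range (fun x ↦ i₂.left.base x) = Set.univ)
    (f : Y ⟶ W) :
    Set.range (fun y ↦ f.left.base y) ⊆ Set.range (fun x ↦ i₁.left.base x) ∨
      Set.range (fun y ↦ f.left.base y) ⊆ Set.range (fun x ↦ i₂.left.base x) := by
  haveI : IrreducibleSpace Y.left :=
    haveI := hY.geometricallyIrreducible
    GeometricallyIrreducible.irreducibleSpace_of_subsingleton Y.hom
  have h₁ : IsClosed ((fun y ↦ f.left.base y) ⁻¹' Set.range (fun x ↦ i₁.left.base x)) :=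
    i₁.left.isClosedEmbedding.isClosed_range.preimage f.left.base.hom.continuous
  have h₂ : IsClosed ((fun y ↦ f.left.base y) ⁻¹' Set.range (fun x ↦ i₂.left.base x)) :=
    i₂.left.isClosedEmbedding.isClosed_range.preimage f.left.base.hom.continuous
  have huniv : (Set.univ : Set Y.left) ⊆
      (fun y ↦ f.left.base y) ⁻¹' Set.range (fun x ↦ i₁.left.base x) ∪
        (fun y ↦ f.left.base y) ⁻¹' Set.range (fun x ↦ i₂.left.base x) := by
    intro y _
    have : f.left.base y ∈ Set.range (fun x ↦ i₁.left.base x) ∪ Set.range (fun x ↦ i₂.left.base x) := by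
      rw [hcov]; trivial
    exact this
  rcases (isPreirreducible_iff_isClosed_union_isClosed.1
      (PreirreducibleSpace.isPreirreducible_univ (X := Y.left))) _ _ h₁ h₂ huniv with h | h
  · left
    rintro _ ⟨y, rfl⟩
    exact h (Set.mem_univ y)
  · right
    rintro _ ⟨y, rfl⟩
    exact h (Set.mem_univ y)

/-- A morphism `f : Y ⟶ W` of `ℂ`-schemes from a REDUCED `Y` whose range lies in the range of a
closed immersion `i : P ⟶ W` factors through `i` in `SchemeOver ℂ` (lift of
`Resolution.IsClosedImmersion.liftOfRange` to the over category). [folklore] -/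
theorem exists_fac_of_range_subset {Y W P : SchemeOver ℂ} [IsReduced Y.left] (i : P ⟶ W)
    [IsClosedImmersion i.left] (f : Y ⟶ W)
    (h : Set.range (fun y ↦ f.left.base y) ⊆ Set.range (fun x ↦ i.left.base x)) :
    ∃ g : Y ⟶ P, g ≫ i = f := by
  let g' : Y.left ⟶ P.left :=
    Literature.AlgebraicGeometry.Resolution.IsClosedImmersion.liftOfRange i.left f.left h
  have hg' : g' ≫ i.left = f.left :=
    Literature.AlgebraicGeometry.Resolution.IsClosedImmersion.liftOfRange_fac i.left f.left h
  refine ⟨Over.homMk g' ?_, ?_⟩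
  · rw [← Over.w i, ← Category.assoc, hg', Over.w f]
  · ext : 1
    simpa using hg'

/-- **The Hodge clause of Bloch's counterexample is automatic.** If `W` is covered by the ranges
of two closed immersions `i₁ i₂ : P ⟶ W` from a smooth projective `P` with `ℚ·Aᵖ(P) = H²ᵖ(P)`,
then every class `α ∈ H²ᵖ(W)` is a Hodge class on all smooth pull-backs: a smooth projective
`Y` is irreducible and reduced, so `f : Y ⟶ W` factors as `g ≫ iⱼ`, and
`f*α = g*(iⱼ*α)` with `iⱼ*α` algebraic, hence Hodge, and `g*` a morphism of Hodge structures.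
(Bloch: "`H⁴(W, ℚ(2)) ≅ ℚ^{⊕3}` (as a Hodge structure)".) [cite: Bloch1990LetterJannsen, p. 222] -/
theorem isHodgeOnSmoothPullbacks_of_closedCover {nP : ℕ} {W P : SchemeOver ℂ}
    (hP : IsSmoothProjective nP P) (i₁ i₂ : P ⟶ W) [IsClosedImmersion i₁.left]
    [IsClosedImmersion i₂.left]
    (hcov : Set.range (fun x ↦ i₁.left.base x) ∪ Set.range (fun x ↦ i₂.left.base x) = Set.univ)
    {p : ℕ} (halg : B.W.algebraicClasses P p = ⊤) (α : B.W.obj W (2 * p)) :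
    IsHodgeOnSmoothPullbacks B W p α := by
  intro m Y hY f
  haveI : IsReduced Y.left := isReduced_left_of_isSmoothProjective hY
  -- the pull-back of `α` to either copy of `P` is algebraic, hence Hodge on all smooth pull-backs
  have hP' : ∀ i : P ⟶ W, IsHodgeOnSmoothPullbacks B P p (B.W.pullback i (2 * p) α) := fun i ↦
    isHodgeOnSmoothPullbacks_of_mem_hodgeClasses hP
      (B.algebraicClasses_le_hodgeClasses hP p (halg ▸ Submodule.mem_top))
  have key : ∀ i : P ⟶ W, ∀ g : Y ⟶ P, g ≫ i = f →
      B.W.pullback f (2 * p) α ∈ (B.hodge hY (2 * p)).hodgeClasses p := by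
    rintro i g rfl
    rw [B.W.pullback_comp]
    exact hP' i hY g
  rcases range_subset_or_of_closedCover hY i₁ i₂ hcov f with h | h
  · obtain ⟨g, hg⟩ := exists_fac_of_range_subset i₁ f h
    exact key i₁ g hg
  · obtain ⟨g, hg⟩ := exists_fac_of_range_subset i₂ f h
    exact key i₂ g hg

variable (B) (C : ChernClassTheory B.W.toPreWeilCohomology)

/-- **Bloch's counterexample, reduced to its cohomological and Chern-theoretic content.** The
named fact `Bloch1990_cohomologicalHodgeConjecture_singular_counterexample B C` follows from the
existence of `(W, P, i₁, i₂)` satisfying its clauses WITHOUT the Hodge clause "every class of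
`H⁴(W)` is Hodge on all smooth pull-backs", which is supplied by
`isHodgeOnSmoothPullbacks_of_closedCover`. What remains is: `W = P ∐_S P` reduced projective of
dimension `3` covered by two closed immersions of the smooth projective threefold `P`;
`ℚ·A²(P) = H⁴(P)`; `H⁴(W) ↪ H⁴(P)²`; `dim_ℚ H⁴(W) = 3`; and `chernSpanTwo B C W ≠ ⊤`
("`Ker(CH²(P)_ℚ^{⊕2} → CH²(S)) ≅ ℚ^{⊕2}` […] no contravariant Chow group can provide the extra
element needed"). [cite: Bloch1990LetterJannsen, pp. 222–223, Remark 1] -/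
theorem Bloch1990_cohomologicalHodgeConjecture_singular_counterexample_of_cohomological
    (h : ∃ (W P : SchemeOver ℂ) (_ : IsSmoothProjective 3 P) (i₁ i₂ : P ⟶ W),
      IsProjectiveOver W ∧ IsReduced W.left ∧ schemeDim W.left = 3 ∧
      IsClosedImmersion i₁.left ∧ IsClosedImmersion i₂.left ∧
      (Set.range (fun x ↦ i₁.left.base x) ∪ Set.range (fun x ↦ i₂.left.base x) = Set.univ) ∧
      B.W.algebraicClasses P 2 = ⊤ ∧
      (∀ α : B.W.obj W (2 * 2),
        B.W.pullback i₁ (2 * 2) α = 0 → B.W.pullback i₂ (2 * 2) α = 0 → α = 0) ∧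
      Module.finrank ℚ (B.W.obj W (2 * 2)) = 3 ∧
      chernSpanTwo B C W ≠ ⊤) :
    Bloch1990_cohomologicalHodgeConjecture_singular_counterexample B C := by
  obtain ⟨W, P, hP, i₁, i₂, hproj, hred, hdim, hi₁, hi₂, hcov, halg, hinj, hrk, hspan⟩ := h
  haveI := hi₁
  haveI := hi₂
  exact ⟨W, P, hP, i₁, i₂, hproj, hred, hdim, hi₁, hi₂, hcov, halg, hinj, hrk,
    isHodgeOnSmoothPullbacks_of_closedCover hP i₁ i₂ hcov halg, hspan⟩

/-- Conversely (trivially), the fact implies its cohomological clauses: the two formulations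
are equivalent. [cite: Bloch1990LetterJannsen, pp. 222–223] -/
theorem Bloch1990_cohomologicalHodgeConjecture_singular_counterexample_iff_cohomological :
    Bloch1990_cohomologicalHodgeConjecture_singular_counterexample B C ↔
      ∃ (W P : SchemeOver ℂ) (_ : IsSmoothProjective 3 P) (i₁ i₂ : P ⟶ W),
        IsProjectiveOver W ∧ IsReduced W.left ∧ schemeDim W.left = 3 ∧
        IsClosedImmersion i₁.left ∧ IsClosedImmersion i₂.left ∧
        (Set.range (fun x ↦ i₁.left.base x) ∪ Set.range (fun x ↦ i₂.left.base x) = Set.univ) ∧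
        B.W.algebraicClasses P 2 = ⊤ ∧
        (∀ α : B.W.obj W (2 * 2),
          B.W.pullback i₁ (2 * 2) α = 0 → B.W.pullback i₂ (2 * 2) α = 0 → α = 0) ∧
        Module.finrank ℚ (B.W.obj W (2 * 2)) = 3 ∧
        chernSpanTwo B C W ≠ ⊤ := by
  refine ⟨fun h ↦ ?_,
    Bloch1990_cohomologicalHodgeConjecture_singular_counterexample_of_cohomological B C⟩
  obtain ⟨W, P, hP, i₁, i₂, hproj, hred, hdim, hi₁, hi₂, hcov, halg, hinj, hrk, -, hspan⟩ := h
  exact ⟨W, P, hP, i₁, i₂, hproj, hred, hdim, hi₁, hi₂, hcov, halg, hinj, hrk, hspan⟩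

end Literature.Barriers.HodgeConjecture

end
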